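import Mathlib
import Literature.Probability.Percolation.MinOpenCut
import Literature.Probability.Percolation.SiteConnectionTools
import Literature.Probability.Percolation.BondPercolationSymmetry
import Literature.Probability.Percolation.LatticeSymmetry
import Literature.Probability.Percolation.InequalitiesProofs
import Summits.CriticalPhenomena.PercolationContinuityZ3.Theorems.PercBudgetLadderPinholeClosingStubHarrisTiles
import Summits.CriticalPhenomena.PercolationContinuityZ3.Theorems.PercBudgetLadderPinholeClosingHalfspaceHalving
import Summits.CriticalPhenomena.PercolationContinuityZ3.Theorems.PinholeClosing.Negative.PinholeClosingResistance
import HarnessLib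

/-!
# Crux `PercBudgetLadder.PinholeClosing` (stmt-CriticalPhenomena-5249), line `budget-halving` (SHELL form) — stub `stub_shellSqueeze`

Helper file for the crux skeleton of lead `prover-line-stmt-CriticalPhenomena-5249-c3-0`
(`Cruxes/PinholeClosing/Lines/budget_halving.lean`, reshaped shell form); proves exactly the registered
stub `stub_shellSqueeze` (`--supports stmt-CriticalPhenomena-5249`).  No new definitions: every statement is
in the tree's vocabulary (`bondPercolation (zdGraph 3) (criticalProbI 3)`, `box`, `innerBoundary`,
`openConnIn`, raw budget set-builders as in the route file).

**What.**  Write `P = bondPercolation (zdGraph 3) (criticalProbI 3)` (bond percolation on `ℤ³` at `p_c`).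
A budget-`j` blocked window event `{ω | ∃ S, #S ≤ j ∧ no (ω ∖ S)-open path inside y + box L from
y + box n to y + ∂ⁱⁿ box L}` is DECREASING in `ω` and depends only on the edges of the finite window.
The stub is the probabilistic squeeze of the line: IF the centred window `box n → ∂ⁱⁿ box (3lu)` is
budget-`j` blocked with probability `≥ c ≥ 0`, AND (deterministic exclusion, a hypothesis here) on lattice
configurations the caps at every surface translate `u • z` (`z ∈ box (4l) ∖ box (4l-1)`) force the window
`box u → ∂ⁱⁿ box (12lu)` to be budget-`(j-1)` blocked at some grid translate `u • z`, `z ∈ box (4l)`, THEN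
`c ^ ((8l+1)³) ≤ (8l+1)³ · P(budget j-1 at (u, 12lu))`.

**How.**  (1) `c ≤ P(centred cap) ≤ 1` and `#surface ≤ #box 3 (4l) = (8l+1)³`, so
`c^((8l+1)³) ≤ c^#surface`.  (2) Shift invariance (`bondPercolation_real_preimage_shift` +
`HalfspaceHalving.preimage_relabel_budgetBlocked` with `φ = Site.shift y`): every translated budget event has
the probability of the centred one (`ShellSqueeze.real_budgetBlocked_shift`).  (3) Each cap is decreasing
(`isUpperSet_openConnIn`) and measurable (`minOpenCutIn_le_iff` + `measurableSet_setOf_minOpenCutIn_le`, the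
window being finite).  (4) Harris–FKG over the surface finset (`StubHarrisTiles.pow_card_le_real_biInter`):
`c^#surface ≤ P(⋂ caps)`.  (5) The exclusion holds `P`-a.s. (`Negative.real_mono_of_lattice`), so
`P(⋂ caps) ≤ P(⋃_{z ∈ box (4l)} conclusion at u • z) ≤ Σ_z P(…) = (8l+1)³ · P(centred conclusion)`
(`measureReal_biUnion_finset_le`, (2), `card_box`).  The abstract chain is `ShellSqueeze.squeeze`.
-/

noncomputable section

namespace Summit.CriticalPhenomena.PercolationContinuityZ3.Theorems

open MeasureTheory
open scoped Classical
open Literature.Probability.Percolation Literature.Probability.LatticeModels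
open Summit.CriticalPhenomena.PercolationContinuityZ3.Theorems.PinholeClosing.Negative

namespace ShellSqueeze

/-- A budget-blocked event (closing at most `j` edges leaves no open path from `A` to `B` inside `F`) is
DECREASING: closing further edges only helps (same `S`; `isUpperSet_openConnIn` applied to
`ω' ∖ S ⊆ ω ∖ S`). -/
theorem isLowerSet_budgetBlocked {V : Type*} (F : Set V) (A B : Finset V) (j : ℕ) :
    IsLowerSet {ω : BondConfig V | ∃ S : Finset (Sym2 V), S.card ≤ j ∧ ¬ ∃ x ∈ A, ∃ y ∈ B,
      (ω \ (↑S : Set (Sym2 V))) ∈ openConnIn F x y} := by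
  rintro ω ω' hle ⟨S, hS, hb⟩
  refine ⟨S, hS, fun ⟨x, hx, y, hy, h⟩ => hb ⟨x, hx, y, hy, ?_⟩⟩
  exact isUpperSet_openConnIn F x y (Set.sdiff_subset_sdiff_left hle) h

/-- A budget-blocked event of a FINITE window `F ⊆ ℤ³` is the min-cut event `{minOpenCutIn ↑F ↑A ↑B ≤ j}`
(`minOpenCutIn_le_iff`). -/
theorem setOf_budgetBlocked_eq_setOf_minCut (F A B : Finset (Site 3)) (j : ℕ) :
    {ω : BondConfig (Site 3) | ∃ S : Finset (Sym2 (Site 3)), S.card ≤ j ∧ ¬ ∃ x ∈ A, ∃ y ∈ B,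
        (ω \ (↑S : Set (Sym2 (Site 3)))) ∈ openConnIn (↑F : Set (Site 3)) x y} =
      {ω | minOpenCutIn (↑F : Set (Site 3)) ↑A ↑B ω ≤ j} := by
  ext ω
  simp only [Set.mem_setOf_eq, minOpenCutIn_le_iff, Finset.mem_coe]

/-- A budget-blocked event of a FINITE window `F ⊆ ℤ³` is measurable (a cylinder event of the edges meeting
`F`; `measurableSet_setOf_minOpenCutIn_le`). -/
theorem measurableSet_budgetBlocked (F A B : Finset (Site 3)) (j : ℕ) :
    MeasurableSet {ω : BondConfig (Site 3) | ∃ S : Finset (Sym2 (Site 3)), S.card ≤ j ∧ ¬ ∃ x ∈ A, ∃ y ∈ B,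
      (ω \ (↑S : Set (Sym2 (Site 3)))) ∈ openConnIn (↑F : Set (Site 3)) x y} := by
  rw [setOf_budgetBlocked_eq_setOf_minCut]
  exact measurableSet_setOf_minOpenCutIn_le (Finset.finite_toSet _) _ _ j

/-- The shift `x ↦ x + y` maps `↑A` onto `↑(A.image (· + y))`. -/
theorem image_shift_coe (A : Finset (Site 3)) (y : Site 3) :
    ⇑(Site.shift y) '' (↑A : Set (Site 3)) = ↑(A.image (· + y)) := by
  ext x
  simp only [Set.mem_image, Finset.mem_coe, Site.shift_apply, Finset.mem_image]

/-- **Shift invariance of budget-blocked events.**  The budget-`j` blocked event of the translated data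
`(A + y, B + y, F + y)` has the same critical probability as that of `(A, B, F)`
(`bondPercolation_real_preimage_shift` and `HalfspaceHalving.preimage_relabel_budgetBlocked` with
`φ = Site.shift y`). -/
theorem real_budgetBlocked_shift (A B F : Finset (Site 3)) (y : Site 3) (j : ℕ) :
    (bondPercolation (zdGraph 3) (criticalProbI 3)).real
        {ω : BondConfig (Site 3) | ∃ S : Finset (Sym2 (Site 3)), S.card ≤ j ∧
          ¬ ∃ x ∈ A.image (· + y), ∃ z ∈ B.image (· + y),
            (ω \ (↑S : Set (Sym2 (Site 3)))) ∈ openConnIn (↑(F.image (· + y)) : Set (Site 3)) x z} =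
      (bondPercolation (zdGraph 3) (criticalProbI 3)).real
        {ω : BondConfig (Site 3) | ∃ S : Finset (Sym2 (Site 3)), S.card ≤ j ∧ ¬ ∃ x ∈ A, ∃ z ∈ B,
          (ω \ (↑S : Set (Sym2 (Site 3)))) ∈ openConnIn (↑F : Set (Site 3)) x z} := by
  have key := HalfspaceHalving.preimage_relabel_budgetBlocked (Site.shift y) (↑F : Set (Site 3))
    (↑A : Set (Site 3)) (↑B : Set (Site 3)) j
  rw [image_shift_coe, image_shift_coe, image_shift_coe] at key
  simp only [Finset.mem_coe] at key
  rw [← key, bondPercolation_real_preimage_shift]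

/-- **The abstract squeeze.**  Decreasing measurable events `cap z`, `z ∈ s`, each of probability `≥ c`
(`0 ≤ c ≤ 1`, `#s ≤ N`), such that on lattice configurations `⋂_{z ∈ s} cap z` forces `concl z` for some
`z ∈ t` (`#t = N`), all the `concl z` having the same probability `q`: then `c ^ N ≤ N · q`
(Harris–FKG `StubHarrisTiles.pow_card_le_real_biInter`, `Negative.real_mono_of_lattice`, union bound). -/
theorem squeeze {ι : Type*} (s t : Finset ι) (cap concl : ι → Set (BondConfig (Site 3))) (q c : ℝ)
    (N : ℕ) (hc : 0 ≤ c) (hc1 : c ≤ 1) (hs : s.card ≤ N) (ht : t.card = N)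
    (hlow : ∀ z ∈ s, IsLowerSet (cap z)) (hmeas : ∀ z ∈ s, MeasurableSet (cap z))
    (hbd : ∀ z ∈ s, c ≤ (bondPercolation (zdGraph 3) (criticalProbI 3)).real (cap z))
    (hex : ∀ ω : BondConfig (Site 3), ω ⊆ (zdGraph 3).edgeSet → (∀ z ∈ s, ω ∈ cap z) →
      ∃ z ∈ t, ω ∈ concl z)
    (hconcl : ∀ z ∈ t, (bondPercolation (zdGraph 3) (criticalProbI 3)).real (concl z) = q) :
    c ^ N ≤ (N : ℝ) * q := by
  calc c ^ N ≤ c ^ s.card := pow_le_pow_of_le_one hc hc1 hs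
    _ ≤ (bondPercolation (zdGraph 3) (criticalProbI 3)).real (⋂ z ∈ s, cap z) :=
        StubHarrisTiles.pow_card_le_real_biInter (zdGraph 3) (criticalProbI 3) s cap c hc hlow hmeas hbd
    _ ≤ (bondPercolation (zdGraph 3) (criticalProbI 3)).real (⋃ z ∈ t, concl z) := by
        refine real_mono_of_lattice fun ω hω hmem => ?_
        rw [Set.mem_iInter₂] at hmem
        obtain ⟨z, hz, hzω⟩ := hex ω hω hmem
        exact Set.mem_iUnion₂_of_mem hz hzω
    _ ≤ ∑ z ∈ t, (bondPercolation (zdGraph 3) (criticalProbI 3)).real (concl z) :=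
        measureReal_biUnion_finset_le t concl
    _ = ∑ _z ∈ t, q := Finset.sum_congr rfl hconcl
    _ = (N : ℝ) * q := by rw [Finset.sum_const, ht, nsmul_eq_mul]

end ShellSqueeze

/-- **stub_shellSqueeze** (probabilistic squeeze of the shell form of line `budget-halving`).  IF the centred
window `box n → ∂ⁱⁿ box (3lu)` is budget-`j` blocked with probability `≥ c ≥ 0`, AND the deterministic
exclusion "lattice configuration + caps at every surface translate `u • z` (`z ∈ box (4l) ∖ box (4l-1)`) ⇒
the window `box u → ∂ⁱⁿ box (12lu)` is budget-`(j-1)` blocked at some grid translate `u • z`, `z ∈ box (4l)`"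
holds, THEN `c ^ ((8l+1)³) ≤ (8l+1)³ · P(budget j-1 at (u, 12lu))`.  Proof: `ShellSqueeze.squeeze` with the
caps decreasing (`ShellSqueeze.isLowerSet_budgetBlocked`), measurable (`ShellSqueeze.measurableSet_budgetBlocked`)
and of probability `= P(centred cap) ≥ c` (`ShellSqueeze.real_budgetBlocked_shift`), `c ≤ 1`,
`#surface ≤ #box 3 (4l) = (8l+1)³` (`card_box`), and every translated conclusion of probability
`P(centred conclusion)` (`ShellSqueeze.real_budgetBlocked_shift`). -/
theorem stub_shellSqueeze :
    ∀ (j n l u : ℕ) (c : ℝ), 0 ≤ c →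
      c ≤ (bondPercolation (zdGraph 3) (criticalProbI 3)).real
        {ω : BondConfig (Site 3) | ∃ S : Finset (Sym2 (Site 3)), S.card ≤ j ∧ ¬ ∃ x ∈ box 3 n,
          ∃ y ∈ innerBoundary (zdGraph 3) (box 3 (3 * l * u)),
            (ω \ (↑S : Set (Sym2 (Site 3)))) ∈ openConnIn (↑(box 3 (3 * l * u)) : Set (Site 3)) x y} →
      (∀ ω : BondConfig (Site 3), ω ⊆ (zdGraph 3).edgeSet →
        (∀ z ∈ box 3 (4 * l), z ∉ box 3 (4 * l - 1) →
          ∃ S : Finset (Sym2 (Site 3)), S.card ≤ j ∧ ¬ ∃ x ∈ (box 3 n).image (· + (u : ℤ) • z),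
            ∃ y ∈ (innerBoundary (zdGraph 3) (box 3 (3 * l * u))).image (· + (u : ℤ) • z),
              (ω \ (↑S : Set (Sym2 (Site 3)))) ∈
                openConnIn (↑((box 3 (3 * l * u)).image (· + (u : ℤ) • z)) : Set (Site 3)) x y) →
        ∃ z ∈ box 3 (4 * l), ∃ S : Finset (Sym2 (Site 3)), S.card ≤ j - 1 ∧
          ¬ ∃ x ∈ (box 3 u).image (· + (u : ℤ) • z),
            ∃ y ∈ (innerBoundary (zdGraph 3) (box 3 (12 * l * u))).image (· + (u : ℤ) • z),
              (ω \ (↑S : Set (Sym2 (Site 3)))) ∈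
                openConnIn (↑((box 3 (12 * l * u)).image (· + (u : ℤ) • z)) : Set (Site 3)) x y) →
      c ^ ((8 * l + 1) ^ 3) ≤ (((8 * l + 1) ^ 3 : ℕ) : ℝ) *
        (bondPercolation (zdGraph 3) (criticalProbI 3)).real
          {ω : BondConfig (Site 3) | ∃ S : Finset (Sym2 (Site 3)), S.card ≤ j - 1 ∧ ¬ ∃ x ∈ box 3 u,
            ∃ y ∈ innerBoundary (zdGraph 3) (box 3 (12 * l * u)),
              (ω \ (↑S : Set (Sym2 (Site 3)))) ∈ openConnIn (↑(box 3 (12 * l * u)) : Set (Site 3)) x y} := by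
  intro j n l u c hc hcap hex
  have hc1 : c ≤ 1 := hcap.trans measureReal_le_one
  refine ShellSqueeze.squeeze ((box 3 (4 * l)).filter (fun z => z ∉ box 3 (4 * l - 1))) (box 3 (4 * l))
    (fun z => {ω : BondConfig (Site 3) | ∃ S : Finset (Sym2 (Site 3)), S.card ≤ j ∧
      ¬ ∃ x ∈ (box 3 n).image (· + (u : ℤ) • z),
        ∃ y ∈ (innerBoundary (zdGraph 3) (box 3 (3 * l * u))).image (· + (u : ℤ) • z),
          (ω \ (↑S : Set (Sym2 (Site 3)))) ∈
            openConnIn (↑((box 3 (3 * l * u)).image (· + (u : ℤ) • z)) : Set (Site 3)) x y})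
    (fun z => {ω : BondConfig (Site 3) | ∃ S : Finset (Sym2 (Site 3)), S.card ≤ j - 1 ∧
      ¬ ∃ x ∈ (box 3 u).image (· + (u : ℤ) • z),
        ∃ y ∈ (innerBoundary (zdGraph 3) (box 3 (12 * l * u))).image (· + (u : ℤ) • z),
          (ω \ (↑S : Set (Sym2 (Site 3)))) ∈
            openConnIn (↑((box 3 (12 * l * u)).image (· + (u : ℤ) • z)) : Set (Site 3)) x y})
    _ c ((8 * l + 1) ^ 3) hc hc1 ?_ ?_ ?_ ?_ ?_ ?_ ?_
  · -- the surface has at most `#box 3 (4l) = (8l+1)³` sites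
    calc ((box 3 (4 * l)).filter (fun z => z ∉ box 3 (4 * l - 1))).card ≤ (box 3 (4 * l)).card :=
          Finset.card_filter_le _ _
      _ = (8 * l + 1) ^ 3 := by rw [card_box]; ring
  · -- the grid has exactly `(8l+1)³` sites
    rw [card_box]; ring
  · -- caps are decreasing
    intro z _
    exact ShellSqueeze.isLowerSet_budgetBlocked _ _ _ _
  · -- caps are measurable
    intro z _
    exact ShellSqueeze.measurableSet_budgetBlocked _ _ _ _
  · -- caps have probability `= P(centred cap) ≥ c`
    intro z _
    exact hcap.trans_eq (ShellSqueeze.real_budgetBlocked_shift (box 3 n)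
      (innerBoundary (zdGraph 3) (box 3 (3 * l * u))) (box 3 (3 * l * u)) ((u : ℤ) • z) j).symm
  · -- the exclusion (hypothesis), caps indexed by the surface finset
    intro ω hω hcaps
    exact hex ω hω fun z hz hz' => hcaps z (Finset.mem_filter.2 ⟨hz, hz'⟩)
  · -- every translated conclusion has the probability of the centred one
    intro z _
    exact ShellSqueeze.real_budgetBlocked_shift (box 3 u) (innerBoundary (zdGraph 3) (box 3 (12 * l * u)))
      (box 3 (12 * l * u)) ((u : ℤ) • z) (j - 1)

end Summit.CriticalPhenomena.PercolationContinuityZ3.Theorems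

end
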